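import Literature.Geometry.Lorentzian.AsymptoticFlatness
import Literature.Geometry.Riemannian.IsotropicCurvature
import HarnessLib

/-!
# Asymptotically Cartesian global orthonormal frames on an asymptotically flat end
# (summit `FinalStateConjecture`)

The **framed-end vocabulary** wanted by the line `framed-witten` of the crux `AdmissibleMassNonneg`
(item stmt-FinalStateConjecture-18051, route `ExactKerrEnds`) of the summit `FinalStateConjecture`
(work item `defn-IsAsymptoticallyCartesianFrame`): §1 of the registered skeleton
`Summits/FinalStateConjecture/FinalStateConjecture/Cruxes/AdmissibleMassNonneg/Lines/
framed_witten.lean` (namespace `…Cruxes.AdmissibleMassNonneg.FramedWitten`), landed here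
VERBATIM — same names, same binders, same bodies — so that the `--supports` files of the three
registered stubs `stub_alignedFrame` / `stub_framedWitten` / `stub_orientationCover` can state
them over Literature without importing the Lines file (after `open Literature.Geometry.Lorentzian`
the stub texts elaborate to the same terms). Pattern of `TameFarFrame.lean`.

## Contents (all over the existing notions `E3`, `InitialDataSet`, `AFEnd`, `AFEnd.dataChart`,
## `AFEnd.far`, `AFEnd.IsSoleEnd`, `AFEnd.IsStronglyAsymptoticallyFlatDR`,
## `PseudoRiemannianMetric.IsOrthonormalFrame`)

* `IsSmoothOrthonormalFrame D F` — `F 0, F 1, F 2` are smooth sections of `TX` which are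
  `h_x`-orthonormal at every point `x` (a global trivialisation of the orthonormal frame bundle of
  `(X, h)`);
* `frameChartCoeff e D F i a y = h(F_i, ∂_a)` at the point `Φ(y)` of the end `e`, `R < ‖y‖`
  (`Φ = e.dataChart`, `∂_a = dΦ_y(e_a)`), junk value `δ_{ia}` inside the ball;
* `IsAsymptoticallyCartesian e D F` — `h(F_i, ∂_a) − δ_{ia} = O₁(‖y‖⁻¹)` along
  `Bornology.cobounded E3` (`m ≤ 1` derivatives, `‖∂^m(·)‖ = O(‖y‖^{-1-m})`);
* `HasFinitelyManyDREnds D e` — finitely many ends `ends 0 = e, …, ends m`, each carrying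
  Dafermos–Rodnianski strongly asymptotically flat data of some mass, whose far regions cover `X`
  up to a compact set;
* the proved lemma asked for by the item, `hasFinitelyManyDREnds_of_isSoleEnd` (a sole DR end is
  the case `m = 0`), plus cheap API: the projections of `IsSmoothOrthonormalFrame`
  (`contMDiff`, `isOrthonormalFrame`, `inner_self`, `inner_of_ne`), the unfolding of
  `frameChartCoeff` on and off the exterior region, and for an asymptotically Cartesian frame the
  consequences `frameChartCoeff − δ = O(‖y‖⁻¹)`, `frameChartCoeff → δ` at infinity and
  `‖D frameChartCoeff‖ = O(‖y‖⁻²)` (the two cases `m = 0, 1` unpacked).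

## Sources and status

Parker–Taubes, *On Witten's proof of the positive energy theorem*, Comm. Math. Phys. 84 (1982):
§1, condition (i), p. 224 — "there is a compact set `K ⊂ M` such that `M − K` is the disjoint
union of a finite number of subsets `M₁, …, M_k` — called the ends of `M` — each diffeomorphic to
the complement of a contractible compact set in `ℝ³`" (`HasFinitelyManyDREnds`, with the tree's
DR decay class in place of Parker–Taubes' `O(1/r)` rates); p. 232 — "the hypotheses allow for an
orthonormal coframe `{eⁱ}` with `|eⁱ − dxⁱ| = O(1/r)`" (`IsAsymptoticallyCartesian`, stated for
the dual frame and with the one derivative the line needs); §2, p. 227 — the spin structure is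
trivial over the ends (global frames trivialise the spinor bundle; Lawson–Michelsohn, *Spin
Geometry*, Ch. II §1). The four predicates are VOCABULARY posited by the line
(planner `planner-cstrat-stmt-FinalStateConjecture-18051-b1-0`, 2026-08-17) and recorded here so
that its stubs can be restated readably; nothing is asserted about them (the existence of an
asymptotically Cartesian global orthonormal frame on orientable `X` is exactly the content of the
stub `stub_alignedFrame`).

## Mathlib

No frame bundles or spin structures in Mathlib; used are smooth sections of the tangent bundle as
maps into `Bundle.TotalSpace` (`ContMDiff (𝓡 3) ((𝓡 3).prod 𝓘(ℝ, E3))`), `mfderiv`,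
`iteratedFDeriv`, `Asymptotics.IsBigO` along `Bornology.cobounded`, `norm_iteratedFDeriv_zero`,
`norm_iteratedFDeriv_one`, `fderiv_sub_const`, `tendsto_norm_cobounded_atTop`.

## Not here

The registered stubs themselves and the spinor architecture of §4 of the skeleton (`pauli`, `cl`,
`nablaHat`, `diracWitten`, …), which are summit-side (`--supports` files of the line); no frame is
constructed here (that is the content of `stub_alignedFrame`, differential topology).
-/

noncomputable section

open scoped Manifold ContDiff Topology
open Set Filter Bundle Asymptotics Bornology

universe u

namespace Literature.Geometry.Lorentzian

variable {X : Type u} [TopologicalSpace X] [ChartedSpace E3 X] [IsManifold (𝓡 3) ∞ X]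

/-! ### Smooth global orthonormal frames -/

/-- A **smooth global `h`-orthonormal frame** of the data `D = (h, k)` on `X`: three smooth vector
fields `F 0, F 1, F 2` (smooth sections of `TX`) which are `h_x`-orthonormal at every point — a
trivialisation of the orthonormal frame bundle of `(X, h)`, hence of its spinor bundle
(Parker–Taubes 1982, §2; Lawson–Michelsohn, *Spin Geometry*, Ch. II §1).
[cite: ParkerTaubes1982, §2, p. 227] -/
def IsSmoothOrthonormalFrame (D : InitialDataSet (𝓡 3) X)
    (F : Fin 3 → Π x : X, TangentSpace (𝓡 3) x) : Prop :=
  (∀ i, ContMDiff (𝓡 3) ((𝓡 3).prod 𝓘(ℝ, E3)) ∞ fun x ↦ TotalSpace.mk' E3 x (F i x)) ∧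
    ∀ x, D.metric.IsOrthonormalFrame x fun i ↦ F i x

namespace IsSmoothOrthonormalFrame

variable {D : InitialDataSet (𝓡 3) X} {F : Fin 3 → Π x : X, TangentSpace (𝓡 3) x}

/-- Each vector field of a smooth orthonormal frame is a smooth section of `TX`. [folklore] -/
theorem contMDiff (h : IsSmoothOrthonormalFrame D F) (i : Fin 3) :
    ContMDiff (𝓡 3) ((𝓡 3).prod 𝓘(ℝ, E3)) ∞ fun x ↦ TotalSpace.mk' E3 x (F i x) :=
  h.1 i

/-- A smooth orthonormal frame is `h_x`-orthonormal at every point. [folklore] -/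
theorem isOrthonormalFrame (h : IsSmoothOrthonormalFrame D F) (x : X) :
    D.metric.IsOrthonormalFrame x fun i ↦ F i x :=
  h.2 x

/-- The vectors of a smooth orthonormal frame are `h`-unit vectors: `h_x(F_i, F_i) = 1`.
[folklore] -/
theorem inner_self (h : IsSmoothOrthonormalFrame D F) (i : Fin 3) (x : X) :
    D.h.inner x (F i x) (F i x) = 1 :=
  (h.2 x).1 i

/-- Distinct vectors of a smooth orthonormal frame are `h`-orthogonal: `h_x(F_i, F_j) = 0` for
`i ≠ j`. [folklore] -/
theorem inner_of_ne (h : IsSmoothOrthonormalFrame D F) {i j : Fin 3} (hij : i ≠ j) (x : X) :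
    D.h.inner x (F i x) (F j x) = 0 :=
  (h.2 x).2 i j hij

/-- In Kronecker form: `h_x(F_i, F_j) = δ_{ij}`. [folklore] -/
theorem inner_eq_ite (h : IsSmoothOrthonormalFrame D F) (i j : Fin 3) (x : X) :
    D.h.inner x (F i x) (F j x) = if i = j then 1 else 0 := by
  split_ifs with hij
  · subst hij
    exact h.inner_self i x
  · exact h.inner_of_ne hij x

end IsSmoothOrthonormalFrame

/-! ### The chart pairings of a frame with the coordinate fields of an end -/

/-- The **chart pairings of a frame with the coordinate fields of the end** `e`: for `R < ‖y‖`,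
`frameChartCoeff e D F i a y = h(F_i, ∂_a)` at the point `Φ(y)` of the end, where
`∂_a = dΦ_y(e_a)` is the push-forward of the `a`-th standard basis vector along the inverse chart
`Φ = e.dataChart`; inside the ball the junk value `δ_{ia}` (invisible along `cobounded`).
(Parker–Taubes 1982, p. 232: comparison of an orthonormal coframe with `dxⁱ` on the end.)
[cite: ParkerTaubes1982, §4, p. 232] -/
def frameChartCoeff (e : AFEnd X) (D : InitialDataSet (𝓡 3) X)
    (F : Fin 3 → Π x : X, TangentSpace (𝓡 3) x) (i a : Fin 3) (y : E3) : ℝ :=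
  if hy : e.R < ‖y‖ then
    D.h.inner (e.dataChart ⟨y, hy⟩) (F i (e.dataChart ⟨y, hy⟩))
      (mfderiv 𝓘(ℝ, E3) (𝓡 3) e.dataChart ⟨y, hy⟩ (EuclideanSpace.single a 1))
  else if i = a then 1 else 0

section frameChartCoeff

variable (e : AFEnd X) (D : InitialDataSet (𝓡 3) X) (F : Fin 3 → Π x : X, TangentSpace (𝓡 3) x)
  (i a : Fin 3)

/-- On the exterior region `R < ‖y‖` the chart pairing is `h(F_i, dΦ_y(e_a))` at `Φ(y)`.
[folklore] -/
theorem frameChartCoeff_of_lt {y : E3} (hy : e.R < ‖y‖) :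
    frameChartCoeff e D F i a y =
      D.h.inner (e.dataChart ⟨y, hy⟩) (F i (e.dataChart ⟨y, hy⟩))
        (mfderiv 𝓘(ℝ, E3) (𝓡 3) e.dataChart ⟨y, hy⟩ (EuclideanSpace.single a 1)) :=
  dif_pos hy

/-- Inside the closed ball `‖y‖ ≤ R` the chart pairing takes the junk value `δ_{ia}`.
[folklore] -/
theorem frameChartCoeff_of_not_lt {y : E3} (hy : ¬ e.R < ‖y‖) :
    frameChartCoeff e D F i a y = if i = a then 1 else 0 :=
  dif_neg hy

/-- Inside the closed ball the deviation `frameChartCoeff − δ_{ia}` vanishes (so the junk value is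
invisible in every decay statement along `cobounded E3`). [folklore] -/
theorem frameChartCoeff_sub_ite_of_not_lt {y : E3} (hy : ¬ e.R < ‖y‖) :
    frameChartCoeff e D F i a y - (if i = a then (1 : ℝ) else 0) = 0 := by
  rw [frameChartCoeff_of_not_lt e D F i a hy, sub_self]

end frameChartCoeff

/-! ### Asymptotically Cartesian frames -/

/-- The frame `F` is **asymptotically Cartesian on the end `e`**: in the chart,
`h(F_i, ∂_a) - δ_{ia} = O₁(‖y‖⁻¹)`, i.e. `|∂^m (h(F_i, ∂_a) - δ_{ia})(y)| = O(‖y‖^{-1-m})` for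
`m ≤ 1` (Parker–Taubes 1982, p. 232: "an orthonormal coframe `{eⁱ}` with `|eⁱ - dxⁱ| = O(1/r)`",
with the one derivative that makes the frame's connection coefficients `O(r⁻²)`, square
integrable on the end). [cite: ParkerTaubes1982, §4, p. 232] -/
def IsAsymptoticallyCartesian (e : AFEnd X) (D : InitialDataSet (𝓡 3) X)
    (F : Fin 3 → Π x : X, TangentSpace (𝓡 3) x) : Prop :=
  ∀ (i a : Fin 3) (m : ℕ), m ≤ 1 →
    (fun y ↦ ‖iteratedFDeriv ℝ m
        (fun z ↦ frameChartCoeff e D F i a z - if i = a then (1 : ℝ) else 0) y‖)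
      =O[Bornology.cobounded E3] fun y ↦ ‖y‖ ^ (-1 - (m : ℝ))

namespace IsAsymptoticallyCartesian

variable {e : AFEnd X} {D : InitialDataSet (𝓡 3) X} {F : Fin 3 → Π x : X, TangentSpace (𝓡 3) x}

/-- The defining decay of an asymptotically Cartesian frame, `m ≤ 1` derivatives. [folklore] -/
theorem isBigO_iteratedFDeriv (h : IsAsymptoticallyCartesian e D F) (i a : Fin 3) {m : ℕ}
    (hm : m ≤ 1) :
    (fun y ↦ ‖iteratedFDeriv ℝ m
        (fun z ↦ frameChartCoeff e D F i a z - if i = a then (1 : ℝ) else 0) y‖)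
      =O[Bornology.cobounded E3] fun y ↦ ‖y‖ ^ (-1 - (m : ℝ)) :=
  h i a m hm

/-- Order zero: `h(F_i, ∂_a) − δ_{ia} = O(‖y‖⁻¹)` at infinity (Parker–Taubes 1982, p. 232,
`|eⁱ − dxⁱ| = O(1/r)`). [cite: ParkerTaubes1982, §4, p. 232] -/
theorem isBigO_sub_ite (h : IsAsymptoticallyCartesian e D F) (i a : Fin 3) :
    (fun y ↦ frameChartCoeff e D F i a y - if i = a then (1 : ℝ) else 0)
      =O[Bornology.cobounded E3] fun y ↦ ‖y‖⁻¹ := by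
  have h0 := h i a 0 zero_le_one
  simp only [norm_iteratedFDeriv_zero, Nat.cast_zero, sub_zero, Real.rpow_neg_one] at h0
  exact isBigO_norm_left.1 h0

/-- An asymptotically Cartesian frame has chart pairings tending to `δ_{ia}` at infinity:
`h(F_i, ∂_a)(y) → δ_{ia}` as `‖y‖ → ∞`. [folklore] -/
theorem tendsto_frameChartCoeff (h : IsAsymptoticallyCartesian e D F) (i a : Fin 3) :
    Tendsto (frameChartCoeff e D F i a) (Bornology.cobounded E3)
      (𝓝 (if i = a then (1 : ℝ) else 0)) := by
  have hinv : Tendsto (fun y : E3 ↦ ‖y‖⁻¹) (Bornology.cobounded E3) (𝓝 0) :=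
    tendsto_inv_atTop_zero.comp tendsto_norm_cobounded_atTop
  have hsub := (h.isBigO_sub_ite i a).trans_tendsto hinv
  have := hsub.add_const (if i = a then (1 : ℝ) else 0)
  simpa using this

/-- Order one: `‖D(h(F_i, ∂_a))(y)‖ = O(‖y‖⁻²)` at infinity (the derivative of the constant
`δ_{ia}` drops out). [folklore] -/
theorem isBigO_norm_fderiv (h : IsAsymptoticallyCartesian e D F) (i a : Fin 3) :
    (fun y ↦ ‖fderiv ℝ (frameChartCoeff e D F i a) y‖)
      =O[Bornology.cobounded E3] fun y ↦ ‖y‖ ^ (-2 : ℝ) := by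
  have h2 : (-1 - ((1 : ℕ) : ℝ)) = -2 := by norm_num
  have h1 := h i a 1 le_rfl
  rw [h2] at h1
  simpa only [norm_iteratedFDeriv_one, fderiv_sub_const] using h1

end IsAsymptoticallyCartesian

/-! ### Finitely many Dafermos–Rodnianski ends -/

/-- **Finitely many Dafermos–Rodnianski ends, one of them `e`**: there are ends
`ends 0 = e, ends 1, …, ends m` of `X`, on each of which the data are strongly asymptotically
flat with some mass, whose far regions cover `X` up to a compact set (Parker–Taubes 1982, §1,
condition (i): `M = K ∪ M₁ ∪ ⋯ ∪ M_k`, `K` compact, each `M_ℓ ≅ ℝ³ ∖ ball` asymptotically flat).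
A sole end is the case `m = 0`. [cite: ParkerTaubes1982, §1, condition (i), p. 224] -/
def HasFinitelyManyDREnds (D : InitialDataSet (𝓡 3) X) (e : AFEnd X) : Prop :=
  ∃ (m : ℕ) (ends : Fin (m + 1) → AFEnd X) (ρ : ℝ), ends 0 = e ∧
    (∀ j, ∃ Mj : ℝ, (ends j).IsStronglyAsymptoticallyFlatDR D Mj) ∧
    IsCompact (⋃ j, (ends j).far ρ)ᶜ

/-- A sole DR end gives `HasFinitelyManyDREnds` with `m = 0`. [folklore] -/
theorem hasFinitelyManyDREnds_of_isSoleEnd {D : InitialDataSet (𝓡 3) X} {e : AFEnd X} {M : ℝ}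
    (hsole : e.IsSoleEnd) (hDR : e.IsStronglyAsymptoticallyFlatDR D M) :
    HasFinitelyManyDREnds D e := by
  obtain ⟨R', -, hcpt⟩ := hsole
  refine ⟨0, fun _ ↦ e, R', rfl, fun _ ↦ ⟨M, hDR⟩, ?_⟩
  simpa [Set.iUnion_const] using hcpt

namespace HasFinitelyManyDREnds

variable {D : InitialDataSet (𝓡 3) X} {e : AFEnd X}

/-- The distinguished end of `HasFinitelyManyDREnds D e` carries DR-flat data of some mass.
[folklore] -/
theorem exists_isStronglyAsymptoticallyFlatDR (h : HasFinitelyManyDREnds D e) :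
    ∃ M : ℝ, e.IsStronglyAsymptoticallyFlatDR D M := by
  obtain ⟨m, ends, ρ, h0, hDR, -⟩ := h
  obtain ⟨M, hM⟩ := hDR 0
  exact ⟨M, h0 ▸ hM⟩

/-- The far regions of the finitely many ends cover `X` up to a compact set. [folklore] -/
theorem exists_isCompact_compl_iUnion_far (h : HasFinitelyManyDREnds D e) :
    ∃ (m : ℕ) (ends : Fin (m + 1) → AFEnd X) (ρ : ℝ), ends 0 = e ∧
      IsCompact (⋃ j, (ends j).far ρ)ᶜ := by
  obtain ⟨m, ends, ρ, h0, -, hcpt⟩ := h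
  exact ⟨m, ends, ρ, h0, hcpt⟩

end HasFinitelyManyDREnds

end Literature.Geometry.Lorentzian

end
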